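import Summits.ResolutionOfSingularities.ResolutionOfSingularities.Theorems.HilbertSamuelEliminationSigmaMaxModificationsCorridor3WLadderIsoInsepPinnedCountdownDefs
import HarnessLib

/-!
# [OURS · L1 W4.2] k2 PART 4 — the two combinatorial rows of the pinned countdown ARE THEOREMS: `TwoDeltaStepLaw₂` and `TwoDeltaNearLaw₂`
# (crux chain w42, cell k2 `T3insep` at `p = 2`, E1 = (γ); `--supports stmt-ResolutionOfSingularities-19249`)

OURS (cell res-hironaka, slot W4.2, seat res-D-pv-042); NOT a statement of [Hironaka2017] nor of [CossartJannsenSaito2020] / [CossartPiltant2009].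
AI-drafted, weaker than expert review. PROOF file, def-free, fact-free: the rows `IdeasL1C6.TwoDeltaStepLaw₂` («`twoDelta (pinnedTransform F) + 2 =
twoDelta F`») and `IdeasL1C6.TwoDeltaNearLaw₂` («`2 ≤ ord (pinnedTransform F) ↔ 4 ≤ twoDelta F`») of k2 PART 4
(`…Corridor3WLadderIsoInsepPinnedCountdownDefs`, res-L1-w42-idea-1 Sketch C8 §8) are exponent bookkeeping for the coefficientwise pinned transform
`u^a w^l ↦ u^a w^{l + |a| − 2}`: it preserves the `u`-degree, is a bijection on the monomials of `u`-degree `≤ 1` shifting the pinned weight by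
exactly `2`, and a monomial `u^a w^l` of the transform has degree `2|a| + l − 2`.

* `twoDeltaStepLaw₂_holds : TwoDeltaStepLaw₂` (the missing half `twoDelta F ≤ twoDelta (pinnedTransform F) + 2` of the sketch's
  `twoDelta_pinnedTransform_add_two_le`, via `ENat.iInf_add`);
* `twoDeltaNearLaw₂_holds : TwoDeltaNearLaw₂`.
What remains OURS in the `e_κ = 1` cell after this file: the dictionary row `PinnedTowerExtraction₂` (and E0), by `isoInsepE1Impossible₂_of_rows`.
-/

noncomputable section

set_option linter.dupNamespace false

open scoped Classical
open MvPowerSeries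

namespace Summit.ResolutionOfSingularities.ResolutionOfSingularities.Cruxes.SigmaMaxModifications.IdeasL1C6

variable {κ : Type} [Field κ]

/-! ## §1. Exponent bookkeeping for `pinnedTransform` -/

/-- The preimage exponent: for `e'` with `uDeg e' ≤ e' 3 + 2`, the coefficient of `u^{a} w^{l'}` in the transform is the coefficient of
`u^{a} w^{l' + 2 − |a|}` in `F`. [folklore] -/
theorem pinnedTransform_apply_of_le (F : MvPowerSeries (Fin 4) κ) {e' : Fin 4 →₀ ℕ} (h : uDeg e' ≤ e' 3 + 2) :
    pinnedTransform F e' = F (e'.update 3 (e' 3 + 2 - uDeg e')) := by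
  show (if uDeg e' ≤ e' 3 + 2 then F (e'.update 3 (e' 3 + 2 - uDeg e')) else 0) = _
  rw [if_pos h]

/-- `uDeg` is unchanged by updating the `w`-exponent. [folklore] -/
theorem uDeg_update_three (e : Fin 4 →₀ ℕ) (n : ℕ) : uDeg (e.update 3 n) = uDeg e := by
  simp [uDeg]

/-- The `w`-exponent after updating. [folklore] -/
theorem update_three_apply_three (e : Fin 4 →₀ ℕ) (n : ℕ) : (e.update 3 n) 3 = n := by
  simp

/-- For a monomial of `u`-degree `≤ 1` of the transform, the preimage monomial has pinned weight exactly `2` more. [folklore] -/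
theorem pinWeight_update_eq_add_two {e' : Fin 4 →₀ ℕ} (hu : uDeg e' ≤ 1) :
    pinWeight (e'.update 3 (e' 3 + 2 - uDeg e')) = pinWeight e' + 2 := by
  unfold pinWeight
  rw [uDeg_update_three, update_three_apply_three]
  split_ifs with h0
  · omega
  · omega

/-! ## §2. `TwoDeltaStepLaw₂` -/

/-- The missing half of the step law: `twoDelta F ≤ twoDelta (pinnedTransform F) + 2`. [OURS · L1 W4.2 · k2] [folklore] -/
theorem twoDelta_le_twoDelta_pinnedTransform_add_two (F : MvPowerSeries (Fin 4) κ) :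
    twoDelta F ≤ twoDelta (pinnedTransform F) + 2 := by
  unfold twoDelta
  rw [ENat.iInf_add]
  refine le_iInf fun e' => ?_
  rw [ENat.iInf_add]
  refine le_iInf fun hu' => ?_
  rw [ENat.iInf_add]
  refine le_iInf fun hne' => ?_
  have hle : uDeg e' ≤ e' 3 + 2 := by omega
  rw [pinnedTransform_apply_of_le F hle] at hne'
  have hw := pinWeight_update_eq_add_two hu'
  refine iInf_le_of_le (e'.update 3 (e' 3 + 2 - uDeg e')) (iInf_le_of_le (by rw [uDeg_update_three]; exact hu') (iInf_le_of_le hne' ?_))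
  rw [hw]; push_cast; exact le_rfl

/-- **`TwoDeltaStepLaw₂` IS A THEOREM**: `twoDelta (pinnedTransform F) + 2 = twoDelta F` for `ord F ≥ 2`. [OURS · L1 W4.2 · k2 · PROVED] [folklore] -/
theorem twoDeltaStepLaw₂_holds : TwoDeltaStepLaw₂ := fun _κ _ F hF =>
  le_antisymm (twoDelta_pinnedTransform_add_two_le F hF) (twoDelta_le_twoDelta_pinnedTransform_add_two F)

/-! ## §3. `TwoDeltaNearLaw₂` -/

/-- If `ord (pinnedTransform F) ≥ 2` and `ord F ≥ 2` then every monomial of `F` of `u`-degree `≤ 1` has pinned weight `≥ 4`. [folklore] -/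
theorem four_le_twoDelta_of_le_order_pinnedTransform (F : MvPowerSeries (Fin 4) κ) (hF : (2 : ℕ∞) ≤ F.order)
    (h : (2 : ℕ∞) ≤ (pinnedTransform F).order) : (4 : ℕ∞) ≤ twoDelta F := by
  unfold twoDelta
  refine le_iInf fun e => le_iInf fun hu => le_iInf fun hne => ?_
  -- `deg e ≥ 2` since `ord F ≥ 2`
  have hdeg : 2 ≤ uDeg e + e 3 := by
    by_contra hlt
    push Not at hlt
    apply hne
    have hlt' : (e.degree : ℕ∞) < F.order := by
      refine lt_of_lt_of_le ?_ hF
      rw [degree_eq_uDeg_add]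
      exact_mod_cast hlt
    exact MvPowerSeries.coeff_of_lt_order hlt'
  -- the transform's monomial `e'`
  set e' : Fin 4 →₀ ℕ := e.update 3 (e 3 - (2 - uDeg e)) with he'
  have hu' : uDeg e' = uDeg e := uDeg_update_three e _
  have h3' : e' 3 = e 3 - (2 - uDeg e) := update_three_apply_three e _
  have hback : e'.update 3 (e' 3 + 2 - uDeg e') = e := by
    ext i
    by_cases hi : i = 3
    · subst hi
      simp only [Finsupp.coe_update, Function.update_self, h3', hu']
      omega
    · simp [he', hi]
  have hval : pinnedTransform F e' = F e := by
    rw [pinnedTransform_apply_of_le F (by rw [hu', h3']; omega), hback]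
  have hne' : MvPowerSeries.coeff e' (pinnedTransform F) ≠ 0 := by
    show pinnedTransform F e' ≠ 0
    rw [hval]; exact hne
  -- so `deg e' ≥ 2`
  have hdeg' : (2 : ℕ∞) ≤ (e'.degree : ℕ∞) := h.trans (MvPowerSeries.order_le hne')
  have hdeg'' : 2 ≤ uDeg e' + e' 3 := by rw [← degree_eq_uDeg_add]; exact_mod_cast hdeg'
  rw [hu', h3'] at hdeg''
  unfold pinWeight
  split_ifs with h0
  · rw [h0] at hdeg''; norm_cast; omega
  · norm_cast; omega

/-- Conversely, `4 ≤ twoDelta F` forces `ord (pinnedTransform F) ≥ 2`. [folklore] -/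
theorem le_order_pinnedTransform_of_four_le_twoDelta (F : MvPowerSeries (Fin 4) κ) (h : (4 : ℕ∞) ≤ twoDelta F) :
    (2 : ℕ∞) ≤ (pinnedTransform F).order := by
  refine MvPowerSeries.nat_le_order fun e' hdeg => ?_
  have hdeg' : uDeg e' + e' 3 < 2 := by rw [← degree_eq_uDeg_add]; exact_mod_cast hdeg
  show pinnedTransform F e' = 0
  have hle : uDeg e' ≤ e' 3 + 2 := by omega
  rw [pinnedTransform_apply_of_le F hle]
  by_contra hne
  have hu : uDeg e' ≤ 1 := by omega
  have hw : (4 : ℕ∞) ≤ pinWeight (e'.update 3 (e' 3 + 2 - uDeg e')) := by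
    refine h.trans ?_
    unfold twoDelta
    exact iInf_le_of_le _ (iInf_le_of_le (by rw [uDeg_update_three]; exact hu) (iInf_le _ hne))
  rw [pinWeight_update_eq_add_two hu] at hw
  unfold pinWeight at hw
  split_ifs at hw with h0
  · rw [h0] at hdeg'
    have : e' 3 + 2 < 4 := by omega
    exact absurd hw (by push_cast; exact_mod_cast not_le.mpr this)
  · have h1 : uDeg e' = 1 := by omega
    rw [h1] at hdeg'
    have : 2 * e' 3 + 2 < 4 := by omega
    exact absurd hw (by push_cast; exact_mod_cast not_le.mpr this)

/-- **`TwoDeltaNearLaw₂` IS A THEOREM**: for `ord F ≥ 2`, `2 ≤ ord (pinnedTransform F) ↔ 4 ≤ twoDelta F` (the pinned point is near iff every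
monomial of `u`-degree `≤ 1` has pinned weight `≥ 4`). [OURS · L1 W4.2 · k2 · PROVED] [folklore] -/
theorem twoDeltaNearLaw₂_holds : TwoDeltaNearLaw₂ := fun _κ _ F hF =>
  ⟨four_le_twoDelta_of_le_order_pinnedTransform F hF, le_order_pinnedTransform_of_four_le_twoDelta F⟩

end Summit.ResolutionOfSingularities.ResolutionOfSingularities.Cruxes.SigmaMaxModifications.IdeasL1C6

end
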